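import Mathlib.CategoryTheory.Galois.GaloisObjects
import Mathlib.Data.Nat.Prime.Defs
import Literature.AnabelianGeometry.Anabelioids.Basic

/-!
# `Σ`-integers and the pro-`Σ` completion of a connected anabelioid ([SemiAnbd] Definition 2.9, p. 31)

Mochizuki, *Semi-graphs of anabelioids*, Publ. RIMS **42** (2006) 221–322, §2, author's manuscript
p. 31 [cite: MochizukiSemiAnbd2006, Def. 2.9 p.31]: (i) a *`Σ`-integer* is a positive integer each of
whose prime factors belongs to the set of primes `Σ`; (ii) the *pro-`Σ` completion* of a connected
anabelioid `A` is "the connected anabelioid constituted by the full subcategory of `A` determined by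
the objects dominated by a Galois covering of the final object of `A` whose degree is a `Σ`-integer".

Rendering: "Galois covering of the final object" = Mathlib `PreGaloisCategory.IsGalois Y` (a
connected Galois object; its degree is `|Aut Y|`); "`X` is dominated by `Y`" = `X` is a quotient of a
finite coproduct of copies of `Y`.  That the full subcategory is again a connected anabelioid is the
NAMED FACT `proSigmaCompletion_galoisCategory`.

Deliberately NOT here: the pro-`Σ` completion of a semi-graph of anabelioids (replace each
constituent by its completion; needs the completed `b_*`, i.e. the fact above as data).
-/

namespace Literature.AnabelianGeometry.Anabelioids

open CategoryTheory CategoryTheory.Limits CategoryTheory.PreGaloisCategory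

universe v₁ u₁

/-- A *`Σ`-integer*: a positive integer each of whose prime factors belongs to the set of primes `Σ`
([SemiAnbd] Def. 2.9 (i)). [cite: MochizukiSemiAnbd2006, Def. 2.9(i) p.31] -/
def IsSigmaInteger (Sigma : Set ℕ) (n : ℕ) : Prop := 0 < n ∧ ∀ p : ℕ, p.Prime → p ∣ n → p ∈ Sigma

section ProSigma

variable {A : Type u₁} [Category.{v₁} A] [GaloisCategory A]

/-- The objects of the *pro-`Σ` completion* of a connected anabelioid `A` ([SemiAnbd] Def. 2.9 (ii)):
"the objects dominated by a Galois covering of the final object of `A` whose degree is a `Σ`-integer"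
— `X` is a quotient of a finite coproduct of copies of a Galois object `Y` (Mathlib `IsGalois`) with
`|Aut Y|` a `Σ`-integer. [cite: MochizukiSemiAnbd2006, Def. 2.9(ii) p.31] -/
def proSigmaObj (Sigma : Set ℕ) : ObjectProperty A := fun X =>
  ∃ (Y : A) (_ : IsGalois Y), IsSigmaInteger Sigma (Nat.card (Aut Y)) ∧
    ∃ (n : ℕ) (f : (∐ fun _ : Fin n => Y) ⟶ X), Epi f

variable (A) in
/-- The *pro-`Σ` completion* of the connected anabelioid `A`: the full subcategory on `proSigmaObj`
([SemiAnbd] Def. 2.9 (ii); that it is again a connected anabelioid is implicit there).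
[cite: MochizukiSemiAnbd2006, Def. 2.9(ii) p.31] -/
abbrev ProSigmaCompletion (Sigma : Set ℕ) := (proSigmaObj (A := A) Sigma).FullSubcategory

/-- NAMED FACT ([SemiAnbd] Def. 2.9 (ii): "the connected anabelioid constituted by the full
subcategory …"): the pro-`Σ` completion of a connected anabelioid is a connected anabelioid.
[cite: MochizukiSemiAnbd2006, Def. 2.9(ii) p.31] -/
def proSigmaCompletion_galoisCategory : Prop :=
  ∀ (A : Type u₁) [Category.{v₁} A] [GaloisCategory A] (Sigma : Set ℕ),
    GaloisCategory (ProSigmaCompletion A Sigma)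

end ProSigma

end Literature.AnabelianGeometry.Anabelioids
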